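import Mathlib
import HarnessLib

/-!
# The Cramér function `g(u) = e^{−u/2}(ψ(e^u) − e^u)` on bounded intervals, its lag-`2b` autocorrelation energy, and a Cesàro lemma (RH-free)

Helper file (`--supports stmt-RiemannHypothesis-0098`, lead-track anchor: Weil-positivity window ladder, format-C far bound),
pure proofs over Mathlib only.  Seat rh-explicit-weil-1 gen16 (memo `run/shared/lean/pub/rh-explicit/rh-explicit-weil-1/FORMAT-K3.md` §17).

The residual energy `J(b)` of the cosh profile — the coefficient of the far-coercivity floor gap — is, under RH, the lag-`2b`
autocorrelation energy `Φ(b) = ∫₀^{2b}(g(u) + g(2b−u))² du` of the CRAMÉR FUNCTION `g(u) = e^{−u/2}(ψ(e^u) − e^u)` up to `O(√Φ + 1)`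
(`WeilFarFloorResidualEnergyCramer`).  This file collects the RH-free facts about `g` used by the Cesàro chain
(`WeilFarFloorResidualEnergyLinearRH`, `WeilFarFloorCramerCrossMeanRH`, `WeilFarFloorCramerLagEnergyMeanRH`, `WeilFarFloorCoshGap*`):
* §1 `g` is measurable, `|g(u)| ≤ ψ(e^V) + e^V` for `u ≤ V` (`0 ≤ V`), `g² = e^{−u}(ψ(e^u) − e^u)²` (the integrand of MV Thm. 13.6), interval
  integrability, `e^b ≤ 2(b + sinh b)`;
* §2 the lag energy: `Φ(b) ≤ 4F(2b)` and `Φ(b) = 2F(2b) + 2X(b)` (`F(U) = ∫₀^U g²`, `X(b) = ∫₀^{2b} g(u)g(2b−u) du`; reflection `u ↦ 2b−u`),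
  `F` monotone, the substitution `∫_{b∈(c,A)} g(2b−u) db = ½(G(2A−u) − G(2c−u))` (`G(V) = ∫₀^V g`);
* §3 the Cesàro lemma `tendsto_cesaro_of_tendsto_div`: `F` monotone and `F(U)/U → β` imply `(1/A²)∫₁^A F(2b) db → β`.
Standard axioms only.  Nothing here bears on the truth of RH.
-/

set_option linter.dupNamespace false
set_option autoImplicit false

noncomputable section

open MeasureTheory Set Filter Topology
open scoped Real BigOperators ArithmeticFunction.vonMangoldt Chebyshev

namespace Summit.RiemannHypothesis.RiemannHypothesis.Theorems.WeilFormatC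

namespace FloorResidualMean

variable {b : ℝ}

/-! ## §1 The Cramér function on bounded intervals -/

/-- The Cramér function `g(u) = e^{−u/2}(ψ(e^u) − e^u)` is measurable. -/
theorem measurable_cramerFn : Measurable fun u : ℝ ↦ Real.exp (-(u / 2)) * (ψ (Real.exp u) - Real.exp u) :=
  (Real.measurable_exp.comp (measurable_id.div_const 2).neg).mul
    ((Chebyshev.psi_mono.measurable.comp Real.measurable_exp).sub Real.measurable_exp)

/-- `|g(u)| ≤ ψ(e^V) + e^V` for `u ≤ V`, `0 ≤ V` (for `u < 0`, `ψ(e^u) = 0` and `|g(u)| = e^{u/2} ≤ 1`). -/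
theorem abs_cramerFn_le {u V : ℝ} (hV : 0 ≤ V) (huV : u ≤ V) :
    |Real.exp (-(u / 2)) * (ψ (Real.exp u) - Real.exp u)| ≤ ψ (Real.exp V) + Real.exp V := by
  have hψV := Chebyshev.psi_nonneg (Real.exp V)
  have hV1 : 1 ≤ Real.exp V := Real.one_le_exp hV
  rcases le_or_gt 0 u with hu | hu
  · have h1 : ψ (Real.exp u) ≤ ψ (Real.exp V) := Chebyshev.psi_mono (Real.exp_le_exp.2 huV)
    have h2 : Real.exp u ≤ Real.exp V := Real.exp_le_exp.2 huV
    have h3 := Chebyshev.psi_nonneg (Real.exp u)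
    have h4 := (Real.exp_pos u).le
    have hd : |ψ (Real.exp u) - Real.exp u| ≤ ψ (Real.exp V) + Real.exp V := by
      rw [abs_le]; constructor <;> linarith
    have he : Real.exp (-(u / 2)) ≤ 1 := Real.exp_le_one_iff.2 (by linarith)
    rw [abs_mul, abs_of_pos (Real.exp_pos _)]
    calc Real.exp (-(u / 2)) * |ψ (Real.exp u) - Real.exp u| ≤ 1 * (ψ (Real.exp V) + Real.exp V) :=
          mul_le_mul he hd (abs_nonneg _) zero_le_one
      _ = _ := one_mul _
  · have hψ0 : ψ (Real.exp u) = 0 := Chebyshev.psi_eq_zero_of_le_one (Real.exp_le_one_iff.2 hu.le)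
    rw [hψ0, zero_sub, mul_neg, abs_neg, ← Real.exp_add, Real.abs_exp]
    have : Real.exp (-(u / 2) + u) ≤ 1 := Real.exp_le_one_iff.2 (by linarith)
    linarith

/-- `g(u)² = e^{−u}(ψ(e^u) − e^u)²` (the integrand of Literature `CramerMeanSquare`). -/
theorem cramerFn_sq (u : ℝ) :
    (Real.exp (-(u / 2)) * (ψ (Real.exp u) - Real.exp u)) ^ 2 = Real.exp (-u) * (ψ (Real.exp u) - Real.exp u) ^ 2 := by
  rw [mul_pow, sq (Real.exp _), ← Real.exp_add]; ring_nf

/-- A measurable function bounded on `[a, c]` is interval integrable there. -/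
theorem intervalIntegrable_of_abs_le {f : ℝ → ℝ} (hf : Measurable f) {a c M : ℝ} (hac : a ≤ c)
    (hM : ∀ u ∈ Icc a c, |f u| ≤ M) : IntervalIntegrable f volume a c := by
  rw [intervalIntegrable_iff_integrableOn_Icc_of_le hac]
  refine Measure.integrableOn_of_bounded (by simp [Real.volume_Icc]) hf.aestronglyMeasurable (M := M) ?_
  exact (ae_restrict_iff' measurableSet_Icc).2 (ae_of_all _ fun x hx ↦ by rw [Real.norm_eq_abs]; exact hM x hx)

/-- `g` is interval integrable on every interval. -/
theorem intervalIntegrable_cramerFn (a c : ℝ) :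
    IntervalIntegrable (fun u : ℝ ↦ Real.exp (-(u / 2)) * (ψ (Real.exp u) - Real.exp u)) volume a c := by
  wlog hac : a ≤ c generalizing a c
  · exact (this c a (not_le.1 hac).le).symm
  exact intervalIntegrable_of_abs_le measurable_cramerFn hac (M := ψ (Real.exp (max c 0)) + Real.exp (max c 0))
    fun _ hu ↦ abs_cramerFn_le (le_max_right _ _) (hu.2.trans (le_max_left _ _))

/-- `e^b ≤ 2(b + sinh b)` for `b ≥ 1/2`. -/
theorem exp_le_two_mul_norm (hb : 1 / 2 ≤ b) : Real.exp b ≤ 2 * (b + Real.sinh b) := by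
  rw [Real.sinh_eq]
  have h1 : Real.exp (-b) ≤ 1 := Real.exp_le_one_iff.2 (by linarith)
  linarith

/-! ## §2 The lag-`2b` autocorrelation energy `Φ(b) = ∫₀^{2b}(g(u)+g(2b−u))²` -/

/-- **`Φ(b) ≤ 4F(2b)`**: `∫₀^{2b}(g(u) + g(2b−u))² ≤ 4∫₀^{2b} g²` (`(p+q)² ≤ 2p² + 2q²` and the reflection `u ↦ 2b − u`). -/
theorem cramerLagEnergy_le (hb : 0 ≤ b) :
    ∫ u in (0 : ℝ)..(2 * b), (Real.exp (-(u / 2)) * (ψ (Real.exp u) - Real.exp u)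
        + Real.exp (-((2 * b - u) / 2)) * (ψ (Real.exp (2 * b - u)) - Real.exp (2 * b - u))) ^ 2
      ≤ 4 * ∫ u in (0 : ℝ)..(2 * b), Real.exp (-u) * (ψ (Real.exp u) - Real.exp u) ^ 2 := by
  set g : ℝ → ℝ := fun u ↦ Real.exp (-(u / 2)) * (ψ (Real.exp u) - Real.exp u) with hg
  have hgm : Measurable g := measurable_cramerFn
  have hgrm : Measurable fun u ↦ g (2 * b - u) := hgm.comp (measurable_const.sub measurable_id)
  set K := ψ (Real.exp (2 * b)) + Real.exp (2 * b) with hK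
  have hgb : ∀ u ∈ Icc 0 (2 * b), |g u| ≤ K := fun u hu ↦ abs_cramerFn_le (by linarith) hu.2
  have hgrb : ∀ u ∈ Icc 0 (2 * b), |g (2 * b - u)| ≤ K := fun u hu ↦
    abs_cramerFn_le (by linarith) (by linarith [hu.1])
  have hb2 : (0 : ℝ) ≤ 2 * b := by linarith
  have i1 : IntervalIntegrable (fun u ↦ g u ^ 2) volume 0 (2 * b) :=
    intervalIntegrable_of_abs_le (hgm.pow_const 2) hb2 (M := K ^ 2) fun u hu ↦ by
      rw [abs_pow]; exact pow_le_pow_left₀ (abs_nonneg _) (hgb u hu) 2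
  have i2 : IntervalIntegrable (fun u ↦ g (2 * b - u) ^ 2) volume 0 (2 * b) :=
    intervalIntegrable_of_abs_le (hgrm.pow_const 2) hb2 (M := K ^ 2) fun u hu ↦ by
      rw [abs_pow]; exact pow_le_pow_left₀ (abs_nonneg _) (hgrb u hu) 2
  have i3 : IntervalIntegrable (fun u ↦ (g u + g (2 * b - u)) ^ 2) volume 0 (2 * b) :=
    intervalIntegrable_of_abs_le ((hgm.add hgrm).pow_const 2) hb2 (M := (K + K) ^ 2) fun u hu ↦ by
      rw [abs_pow]
      exact pow_le_pow_left₀ (abs_nonneg _) ((abs_add_le _ _).trans (add_le_add (hgb u hu) (hgrb u hu))) 2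
  have hmono : ∫ u in (0 : ℝ)..(2 * b), (g u + g (2 * b - u)) ^ 2
      ≤ ∫ u in (0 : ℝ)..(2 * b), (2 * g u ^ 2 + 2 * g (2 * b - u) ^ 2) :=
    intervalIntegral.integral_mono_on hb2 i3 ((i1.const_mul 2).add (i2.const_mul 2)) fun u _ ↦ by
      nlinarith [sq_nonneg (g u - g (2 * b - u))]
  have hrefl : ∫ u in (0 : ℝ)..(2 * b), g (2 * b - u) ^ 2 = ∫ u in (0 : ℝ)..(2 * b), g u ^ 2 := by
    have h := intervalIntegral.integral_comp_sub_left (fun u ↦ g u ^ 2) (a := 0) (b := 2 * b) (2 * b)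
    rw [sub_self, sub_zero] at h
    exact h
  have hsq : ∀ u, g u ^ 2 = Real.exp (-u) * (ψ (Real.exp u) - Real.exp u) ^ 2 := cramerFn_sq
  have heq : ∫ u in (0 : ℝ)..(2 * b), (Real.exp (-(u / 2)) * (ψ (Real.exp u) - Real.exp u)
        + Real.exp (-((2 * b - u) / 2)) * (ψ (Real.exp (2 * b - u)) - Real.exp (2 * b - u))) ^ 2
      = ∫ u in (0 : ℝ)..(2 * b), (g u + g (2 * b - u)) ^ 2 := rfl
  rw [heq]
  calc ∫ u in (0 : ℝ)..(2 * b), (g u + g (2 * b - u)) ^ 2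
      ≤ ∫ u in (0 : ℝ)..(2 * b), (2 * g u ^ 2 + 2 * g (2 * b - u) ^ 2) := hmono
    _ = 2 * (∫ u in (0 : ℝ)..(2 * b), g u ^ 2) + 2 * ∫ u in (0 : ℝ)..(2 * b), g (2 * b - u) ^ 2 := by
        rw [intervalIntegral.integral_add (i1.const_mul 2) (i2.const_mul 2), intervalIntegral.integral_const_mul,
          intervalIntegral.integral_const_mul]
    _ = 4 * ∫ u in (0 : ℝ)..(2 * b), Real.exp (-u) * (ψ (Real.exp u) - Real.exp u) ^ 2 := by
        rw [hrefl]; simp_rw [hsq]; ring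

/-- **`Φ(b) = 2F(2b) + 2X(b)`**: `∫₀^{2b}(g(u)+g(2b−u))² = 2∫₀^{2b}g² + 2∫₀^{2b}g(u)g(2b−u)du` (reflection `u ↦ 2b − u`). -/
theorem cramerLagEnergy_eq (hb : 0 ≤ b) :
    ∫ u in (0 : ℝ)..(2 * b), (Real.exp (-(u / 2)) * (ψ (Real.exp u) - Real.exp u)
        + Real.exp (-((2 * b - u) / 2)) * (ψ (Real.exp (2 * b - u)) - Real.exp (2 * b - u))) ^ 2
      = 2 * (∫ u in (0 : ℝ)..(2 * b), Real.exp (-u) * (ψ (Real.exp u) - Real.exp u) ^ 2)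
        + 2 * ∫ u in (0 : ℝ)..(2 * b), (Real.exp (-(u / 2)) * (ψ (Real.exp u) - Real.exp u))
            * (Real.exp (-((2 * b - u) / 2)) * (ψ (Real.exp (2 * b - u)) - Real.exp (2 * b - u))) := by
  set g : ℝ → ℝ := fun u ↦ Real.exp (-(u / 2)) * (ψ (Real.exp u) - Real.exp u) with hg
  have hgm : Measurable g := measurable_cramerFn
  have hgrm : Measurable fun u ↦ g (2 * b - u) := hgm.comp (measurable_const.sub measurable_id)
  set K := ψ (Real.exp (2 * b)) + Real.exp (2 * b) with hK
  have hgb : ∀ u ∈ Icc 0 (2 * b), |g u| ≤ K := fun u hu ↦ abs_cramerFn_le (by linarith) hu.2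
  have hgrb : ∀ u ∈ Icc 0 (2 * b), |g (2 * b - u)| ≤ K := fun u hu ↦
    abs_cramerFn_le (by linarith) (by linarith [hu.1])
  have hb2 : (0 : ℝ) ≤ 2 * b := by linarith
  have i1 : IntervalIntegrable (fun u ↦ g u ^ 2) volume 0 (2 * b) :=
    intervalIntegrable_of_abs_le (hgm.pow_const 2) hb2 (M := K ^ 2) fun u hu ↦ by
      rw [abs_pow]; exact pow_le_pow_left₀ (abs_nonneg _) (hgb u hu) 2
  have i2 : IntervalIntegrable (fun u ↦ g (2 * b - u) ^ 2) volume 0 (2 * b) :=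
    intervalIntegrable_of_abs_le (hgrm.pow_const 2) hb2 (M := K ^ 2) fun u hu ↦ by
      rw [abs_pow]; exact pow_le_pow_left₀ (abs_nonneg _) (hgrb u hu) 2
  have hpm : Measurable (fun u ↦ g u * g (2 * b - u)) := hgm.mul hgrm
  have i3 : IntervalIntegrable (fun u ↦ 2 * (g u * g (2 * b - u))) volume 0 (2 * b) :=
    (intervalIntegrable_of_abs_le hpm hb2 (M := K * K) fun u hu ↦ by
      rw [abs_mul]; exact mul_le_mul (hgb u hu) (hgrb u hu) (abs_nonneg _) ((abs_nonneg _).trans (hgb u hu))).const_mul 2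
  have hrefl : ∫ u in (0 : ℝ)..(2 * b), g (2 * b - u) ^ 2 = ∫ u in (0 : ℝ)..(2 * b), g u ^ 2 := by
    have h := intervalIntegral.integral_comp_sub_left (fun u ↦ g u ^ 2) (a := 0) (b := 2 * b) (2 * b)
    rw [sub_self, sub_zero] at h
    exact h
  have hsq : ∀ u, g u ^ 2 = Real.exp (-u) * (ψ (Real.exp u) - Real.exp u) ^ 2 := cramerFn_sq
  show ∫ u in (0 : ℝ)..(2 * b), (g u + g (2 * b - u)) ^ 2
      = 2 * (∫ u in (0 : ℝ)..(2 * b), Real.exp (-u) * (ψ (Real.exp u) - Real.exp u) ^ 2)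
        + 2 * ∫ u in (0 : ℝ)..(2 * b), g u * g (2 * b - u)
  have hpt : (fun u ↦ (g u + g (2 * b - u)) ^ 2) = fun u ↦ (g u ^ 2 + g (2 * b - u) ^ 2) + 2 * (g u * g (2 * b - u)) := by
    funext u; ring
  rw [hpt, intervalIntegral.integral_add (i1.add i2) i3, intervalIntegral.integral_add i1 i2, hrefl,
    intervalIntegral.integral_const_mul]
  simp_rw [hsq]
  ring

/-- The mean-square function `F(U) = ∫₀^U g²` is monotone. -/
theorem monotone_cramerMeanSq :
    Monotone fun U : ℝ ↦ ∫ u in (0 : ℝ)..U, Real.exp (-u) * (ψ (Real.exp u) - Real.exp u) ^ 2 := by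
  have hint : ∀ a c : ℝ, IntervalIntegrable (fun u : ℝ ↦ Real.exp (-u) * (ψ (Real.exp u) - Real.exp u) ^ 2) volume a c := by
    intro a c
    have h := (intervalIntegrable_cramerFn a c)
    have h2 : IntervalIntegrable (fun u : ℝ ↦ (Real.exp (-(u / 2)) * (ψ (Real.exp u) - Real.exp u)) ^ 2) volume a c := by
      wlog hac : a ≤ c generalizing a c
      · exact (this c a (intervalIntegrable_cramerFn c a) (not_le.1 hac).le).symm
      exact intervalIntegrable_of_abs_le (measurable_cramerFn.pow_const 2) hac
        (M := (ψ (Real.exp (max c 0)) + Real.exp (max c 0)) ^ 2) fun u hu ↦ by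
          rw [abs_pow]
          exact pow_le_pow_left₀ (abs_nonneg _) (abs_cramerFn_le (le_max_right _ _) (hu.2.trans (le_max_left _ _))) 2
    exact h2.congr fun u _ ↦ cramerFn_sq u
  intro U V hUV
  have h := intervalIntegral.integral_interval_sub_left (hint 0 V) (hint 0 U)
  have hnn : 0 ≤ ∫ u in U..V, Real.exp (-u) * (ψ (Real.exp u) - Real.exp u) ^ 2 :=
    intervalIntegral.integral_nonneg hUV fun u _ ↦ by positivity
  simp only
  linarith

/-- The inner integral after the substitution `v = 2b − u`:
`∫_{b ∈ (c, A)} g(2b − u) db = ½(G(2A − u) − G(2c − u))`, `G(V) = ∫₀^V g` (`0 ≤ 2c − u`, `c ≤ A`). -/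
theorem setIntegral_cramerFn_two_mul_sub {u c A : ℝ} (hcu : 0 ≤ 2 * c - u) (hcA : c ≤ A) :
    ∫ b in Ioo c A, Real.exp (-((2 * b - u) / 2)) * (ψ (Real.exp (2 * b - u)) - Real.exp (2 * b - u))
      = 1 / 2 * ((∫ v in (0 : ℝ)..(2 * A - u), Real.exp (-(v / 2)) * (ψ (Real.exp v) - Real.exp v))
          - ∫ v in (0 : ℝ)..(2 * c - u), Real.exp (-(v / 2)) * (ψ (Real.exp v) - Real.exp v)) := by
  set g : ℝ → ℝ := fun v ↦ Real.exp (-(v / 2)) * (ψ (Real.exp v) - Real.exp v) with hg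
  have h1 : ∫ b in Ioo c A, g (2 * b - u) = ∫ b in c..A, g (2 * b - u) := by
    rw [intervalIntegral.integral_of_le hcA, integral_Ioc_eq_integral_Ioo]
  have h2 : ∫ b in c..A, g (2 * b - u) = (2 : ℝ)⁻¹ • ∫ v in (2 * c - u)..(2 * A - u), g v :=
    intervalIntegral.integral_comp_mul_sub g two_ne_zero u
  have hAu : 0 ≤ 2 * A - u := by linarith
  have h3 : ∫ v in (2 * c - u)..(2 * A - u), g v = (∫ v in (0 : ℝ)..(2 * A - u), g v) - ∫ v in (0 : ℝ)..(2 * c - u), g v :=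
    (intervalIntegral.integral_interval_sub_left (intervalIntegrable_cramerFn _ _)
      (intervalIntegrable_cramerFn _ _)).symm
  show ∫ b in Ioo c A, g (2 * b - u) = 1 / 2 * ((∫ v in (0 : ℝ)..(2 * A - u), g v) - ∫ v in (0 : ℝ)..(2 * c - u), g v)
  rw [h1, h2, h3, smul_eq_mul]
  norm_num

/-! ## §3 A Cesàro lemma -/

/-- **Cesàro lemma**: if `F` is monotone and `F(U)/U → β`, then `(1/A²)∫₁^A F(2b) db → β`. -/
theorem tendsto_cesaro_of_tendsto_div {F : ℝ → ℝ} {β : ℝ} (hmono : Monotone F)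
    (hF : Tendsto (fun U : ℝ ↦ 1 / U * F U) atTop (𝓝 β)) :
    Tendsto (fun A : ℝ ↦ 1 / A ^ 2 * ∫ b in (1 : ℝ)..A, F (2 * b)) atTop (𝓝 β) := by
  have hmono2 : Monotone fun b : ℝ ↦ F (2 * b) := fun x y hxy ↦ hmono (by linarith)
  rw [Metric.tendsto_atTop]
  intro ε hε
  obtain ⟨U₀, hU₀⟩ := eventually_atTop.1 ((Metric.tendsto_nhds.1 hF) (ε / 4) (by positivity))
  set A₁ := max (U₀ / 2) 1 with hA₁
  have hA₁1 : 1 ≤ A₁ := le_max_right _ _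
  -- on [A₁, ∞): |F(2b) − 2βb| ≤ (ε/2)·b
  have hclose : ∀ b : ℝ, A₁ ≤ b → |F (2 * b) - 2 * β * b| ≤ ε / 2 * b := by
    intro b hb
    have hb0 : 0 < b := by linarith
    have h2b : U₀ ≤ 2 * b := by have := le_max_left (U₀ / 2) 1; linarith
    have h := hU₀ (2 * b) h2b
    rw [Real.dist_eq] at h
    have e : F (2 * b) - 2 * β * b = (2 * b) * (1 / (2 * b) * F (2 * b) - β) := by field_simp
    rw [e, abs_mul, abs_of_pos (by linarith : (0 : ℝ) < 2 * b)]
    nlinarith [h.le]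
  -- the head ∫₁^{A₁} is a constant M
  set M := ∫ b in (1 : ℝ)..A₁, F (2 * b) with hM
  set N := max A₁ ((2 * |β| * A₁ ^ 2 + 2 * |M|) / ε + 1) with hN
  refine ⟨N, fun A hA ↦ ?_⟩
  have hAA₁ : A₁ ≤ A := le_trans (le_max_left _ _) hA
  have hA1 : 1 ≤ A := hA₁1.trans hAA₁
  have hA0 : 0 < A := by linarith
  have hAε : (2 * |β| * A₁ ^ 2 + 2 * |M|) / ε < A := by
    have := le_trans (le_max_right _ _) hA; linarith
  -- split the integral
  have hsplit : ∫ b in (1 : ℝ)..A, F (2 * b) = M + ∫ b in A₁..A, F (2 * b) :=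
    (intervalIntegral.integral_add_adjacent_intervals (hmono2.intervalIntegrable) (hmono2.intervalIntegrable)).symm
  -- bound the tail
  have hup : ∫ b in A₁..A, F (2 * b) ≤ ∫ b in A₁..A, (2 * β * b + ε / 2 * b) :=
    intervalIntegral.integral_mono_on hAA₁ hmono2.intervalIntegrable ((by fun_prop : Continuous fun b : ℝ ↦
      2 * β * b + ε / 2 * b).intervalIntegrable _ _) fun b hb ↦ by
        have := (abs_le.1 (hclose b hb.1)).2; linarith
  have hlo : ∫ b in A₁..A, (2 * β * b - ε / 2 * b) ≤ ∫ b in A₁..A, F (2 * b) :=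
    intervalIntegral.integral_mono_on hAA₁ ((by fun_prop : Continuous fun b : ℝ ↦
      2 * β * b - ε / 2 * b).intervalIntegrable _ _) hmono2.intervalIntegrable fun b hb ↦ by
        have := (abs_le.1 (hclose b hb.1)).1; linarith
  have hlin : ∀ c : ℝ, ∫ b in A₁..A, c * b = c * ((A ^ 2 - A₁ ^ 2) / 2) := fun c ↦ by
    rw [intervalIntegral.integral_const_mul, integral_id]
  have hup' : ∫ b in A₁..A, (2 * β * b + ε / 2 * b) = (2 * β + ε / 2) * ((A ^ 2 - A₁ ^ 2) / 2) := by
    rw [← hlin]; congr 1; funext b; ring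
  have hlo' : ∫ b in A₁..A, (2 * β * b - ε / 2 * b) = (2 * β - ε / 2) * ((A ^ 2 - A₁ ^ 2) / 2) := by
    rw [← hlin]; congr 1; funext b; ring
  rw [hup'] at hup
  rw [hlo'] at hlo
  -- conclude
  rw [Real.dist_eq, hsplit]
  have hA2 : 0 < A ^ 2 := by positivity
  have hkey : |M + (∫ b in A₁..A, F (2 * b)) - β * A ^ 2| ≤ |M| + |β| * A₁ ^ 2 + ε / 4 * A ^ 2 := by
    have hA₁2 : A₁ ^ 2 ≤ A ^ 2 := pow_le_pow_left₀ (by linarith) hAA₁ 2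
    have hM1 := le_abs_self M
    have hM2 := neg_abs_le M
    have hβ1 : β * A₁ ^ 2 ≤ |β| * A₁ ^ 2 := mul_le_mul_of_nonneg_right (le_abs_self β) (sq_nonneg _)
    have hβ2 : -|β| * A₁ ^ 2 ≤ β * A₁ ^ 2 := mul_le_mul_of_nonneg_right (neg_abs_le β) (sq_nonneg _)
    have hε1 : 0 ≤ ε * A₁ ^ 2 := by positivity
    have hε2 : 0 ≤ ε * A ^ 2 := by positivity
    have hup2 : ∫ b in A₁..A, F (2 * b) ≤ β * A ^ 2 - β * A₁ ^ 2 + ε / 4 * A ^ 2 - ε / 4 * A₁ ^ 2 := by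
      have e : (2 * β + ε / 2) * ((A ^ 2 - A₁ ^ 2) / 2) = β * A ^ 2 - β * A₁ ^ 2 + ε / 4 * A ^ 2 - ε / 4 * A₁ ^ 2 := by ring
      linarith
    have hlo2 : β * A ^ 2 - β * A₁ ^ 2 - ε / 4 * A ^ 2 + ε / 4 * A₁ ^ 2 ≤ ∫ b in A₁..A, F (2 * b) := by
      have e : (2 * β - ε / 2) * ((A ^ 2 - A₁ ^ 2) / 2) = β * A ^ 2 - β * A₁ ^ 2 - ε / 4 * A ^ 2 + ε / 4 * A₁ ^ 2 := by ring
      linarith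
    rw [abs_le]
    constructor <;> linarith
  have e : 1 / A ^ 2 * (M + ∫ b in A₁..A, F (2 * b)) - β = (M + (∫ b in A₁..A, F (2 * b)) - β * A ^ 2) / A ^ 2 := by
    field_simp
  rw [e, abs_div, abs_of_pos hA2, div_lt_iff₀ hA2]
  have hεA : 0 < ε * A ^ 2 := by positivity
  have h1 : |M| + |β| * A₁ ^ 2 < ε / 2 * A := by
    have := (div_lt_iff₀ hε).1 hAε
    nlinarith
  have hAA : A ≤ A ^ 2 := by nlinarith
  have h2 : ε / 2 * A ≤ ε / 2 * A ^ 2 := mul_le_mul_of_nonneg_left hAA (by positivity)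
  linarith

end FloorResidualMean

end Summit.RiemannHypothesis.RiemannHypothesis.Theorems.WeilFormatC
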